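import Summits.AtomisticToContinuum.Crystallization.Theses.PhononSlackCertificates

/-!
# `NearFarGlueR` (stmt-AtomisticToContinuum-14970), negative side III: the glue toolkit

Helper lemmas behind the standing disprover's structure theorems for the crux
`NearFarGlueR : FarFieldGapR → NearFieldConvexity → CoerciveTwoShellGap` (route
`PhononSlackCertificates`): `CoerciveTwoShellGap → FarFieldGapR` (the far field is a corollary of
the target) and `Descent → ContactGapAt 3 → FarFieldGapR → CoerciveTwoShellGap` (the near field is
not load-bearing; this closes the picked line's `stub_glue`).  Those two theorems conclude route
items positively and therefore live in the crux work file
`Cruxes/NearFarGlueR/Disproof.lean` (§5–§6) and in the item's evidence (`FarFromTarget.lean`); the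
potential-theoretic and combinatorial lemmas they rest on are recorded here so that provers,
ideators and planners can import them:

* `sum_inv_pow_six_tail_le` — tail shell sum: points at distance `≥ r·b₀` from `x i` in an
  `r`-separated configuration have `Σ |x_i − x_k|⁻⁶ ≤ 250·r⁻⁶/b₀`;
* `good_of_good_comp` — `1/20`-goodness transfers from a sub-configuration `x ∘ f` to `x` when no
  removed particle lies within `3/2` of the centre;
* `fibre_count` — the picked line's `stub_fibre`: `#S ≤ (2R/δ+1)³·#T` when `S` lies within `R` of `T`;
* `sum_halfSite_eq_restrict`, `sum_halfSite_sub_eStar` — `Σ_{i∈U} ½Σ_{j≠i} V = E(x∘f) + ½·cross(U,Uᶜ)`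
  and `Σ_i (½Σ_{j≠i} V − e*) = E(x) − N·e*`;
* `glue_arith`, `cross_arith` — the real arithmetic of the convex combination / cross charge.

All `[folklore]`.
-/

noncomputable section

namespace Summit.AtomisticToContinuum.Crystallization.Theorems.NearFarGlueRNegative

open scoped BigOperators
open Literature.MathematicalPhysics.StatisticalMechanics Literature.Geometry.DiscreteGeometry

/-- **Tail shell sum.** If all mutual distances in `x` are `≥ r > 0` and every `k ∈ S` is at
distance `≥ r·b₀` from `x i` (`b₀ ≥ 1`), then `Σ_{k ∈ S} |x_i − x_k|⁻⁶ ≤ 250·r⁻⁶/b₀`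
(the proof of `sum_inv_pow_six_le`, started at shell `b₀`; `Σ_{b ≥ b₀} b⁻² ≤ 2/b₀`). [folklore] -/
theorem sum_inv_pow_six_tail_le {N : ℕ} (x : Fin N → EuclideanSpace ℝ (Fin 3)) {r : ℝ} (hr : 0 < r)
    (hsep : ∀ k l, k ≠ l → r ≤ dist (x k) (x l)) (i : Fin N) (S : Finset (Fin N)) {b₀ : ℕ}
    (hb₀ : 1 ≤ b₀) (hS : ∀ k ∈ S, r * b₀ ≤ dist (x i) (x k)) :
    ∑ k ∈ S, (dist (x i) (x k))⁻¹ ^ 6 ≤ 250 * r⁻¹ ^ 6 / b₀ := by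
  classical
  set m : Fin N → ℕ := fun k => ⌊dist (x i) (x k) / r⌋₊ with hm
  set t := S.image m with ht_def
  have hmem : ∀ k ∈ S, m k ∈ t := fun k hk => Finset.mem_image_of_mem m hk
  have hb₀r : (1 : ℝ) ≤ (b₀ : ℝ) := by exact_mod_cast hb₀
  have hks : ∀ k ∈ S, r ≤ dist (x i) (x k) := fun k hk =>
    le_trans (by nlinarith) (hS k hk)
  have hmb : ∀ k ∈ S, b₀ ≤ m k := fun k hk =>
    Nat.le_floor ((le_div_iff₀ hr).2 (by rw [mul_comm]; exact hS k hk))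
  have hm1 : ∀ k ∈ S, 1 ≤ m k := fun k hk => hb₀.trans (hmb k hk)
  have hmle : ∀ k ∈ S, r * m k ≤ dist (x i) (x k) := fun k hk => by
    have := Nat.floor_le (div_nonneg dist_nonneg hr.le : 0 ≤ dist (x i) (x k) / r)
    rwa [le_div_iff₀ hr, mul_comm] at this
  have hmlt : ∀ k ∈ S, dist (x i) (x k) < (m k + 1) * r := fun k hk => by
    have := Nat.lt_floor_add_one (dist (x i) (x k) / r)
    rwa [div_lt_iff₀ hr] at this
  have step1 : ∑ k ∈ S, (dist (x i) (x k))⁻¹ ^ 6 ≤ ∑ k ∈ S, r⁻¹ ^ 6 * ((m k : ℝ))⁻¹ ^ 6 := by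
    refine Finset.sum_le_sum fun k hk => ?_
    rw [← mul_pow, ← mul_inv]
    have h0 : 0 < r * m k := mul_pos hr (by exact_mod_cast hm1 k hk)
    exact pow_le_pow_left₀ (inv_nonneg.2 dist_nonneg) (inv_anti₀ h0 (hmle k hk)) _
  have step2 : ∑ k ∈ S, r⁻¹ ^ 6 * ((m k : ℝ))⁻¹ ^ 6 =
      ∑ b ∈ t, ((S.filter fun k => m k = b).card : ℝ) * (r⁻¹ ^ 6 * ((b : ℝ))⁻¹ ^ 6) := by
    have := Finset.sum_fiberwise_of_maps_to' hmem (fun b : ℕ => r⁻¹ ^ 6 * ((b : ℝ))⁻¹ ^ 6)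
    simp only [Finset.sum_const, nsmul_eq_mul] at this
    exact this.symm
  have step3 : ∀ b ∈ t, ((S.filter fun k => m k = b).card : ℝ) ≤ (2 * (b : ℝ) + 3) ^ 3 := by
    intro b hb
    set F := S.filter fun k => m k = b with hF
    have hinj : Set.InjOn x F := fun k _ l _ hkl => by
      by_contra hne
      have := hsep k l hne
      rw [hkl, dist_self] at this
      exact absurd this (not_le.2 hr)
    rw [← Finset.card_image_of_injOn hinj]
    have hR : (0 : ℝ) ≤ ((b : ℝ) + 1) * r := by positivity
    have := card_le_of_separated_of_dist_le (F.image x) (x i) hr hR ?_ ?_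
    · rw [finrank_euclideanSpace_fin] at this
      convert this using 2
      field_simp
      ring
    · intro c hc
      obtain ⟨k, hk, rfl⟩ := Finset.mem_image.1 hc
      obtain ⟨hks', hkb⟩ := Finset.mem_filter.1 hk
      rw [dist_comm]
      have := hmlt k hks'
      rw [hkb] at this
      exact this.le
    · intro c hc c' hc' hne
      obtain ⟨k, -, rfl⟩ := Finset.mem_image.1 hc
      obtain ⟨l, -, rfl⟩ := Finset.mem_image.1 hc'
      exact hsep k l fun h => hne (h ▸ rfl)
  have step4 : ∀ b ∈ t, (2 * (b : ℝ) + 3) ^ 3 * (r⁻¹ ^ 6 * ((b : ℝ))⁻¹ ^ 6) ≤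
      125 * r⁻¹ ^ 6 * ((b : ℝ) ^ 2)⁻¹ := by
    intro b hb
    obtain ⟨k, hk, rfl⟩ := Finset.mem_image.1 hb
    have hb1 : (1 : ℝ) ≤ (m k : ℝ) := by exact_mod_cast hm1 k hk
    set β : ℝ := (m k : ℝ)
    have hβ : 0 < β := by linarith
    have hr6 : 0 < r⁻¹ ^ 6 := by positivity
    have key : (2 * β + 3) ^ 3 * (β⁻¹) ^ 6 ≤ 125 * (β ^ 2)⁻¹ := by
      rw [inv_pow, ← div_eq_mul_inv, ← div_eq_mul_inv,
        div_le_div_iff₀ (by positivity) (by positivity)]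
      have h5 : (2 * β + 3) ^ 3 ≤ (5 * β) ^ 3 :=
        pow_le_pow_left₀ (by positivity) (by linarith) 3
      have h6 : β ^ 5 ≤ β ^ 6 := pow_le_pow_right₀ hb1 (by norm_num)
      nlinarith [mul_le_mul_of_nonneg_right h5 (sq_nonneg β)]
    calc (2 * β + 3) ^ 3 * (r⁻¹ ^ 6 * (β⁻¹) ^ 6) = r⁻¹ ^ 6 * ((2 * β + 3) ^ 3 * (β⁻¹) ^ 6) := by
          ring
      _ ≤ r⁻¹ ^ 6 * (125 * (β ^ 2)⁻¹) := mul_le_mul_of_nonneg_left key hr6.le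
      _ = 125 * r⁻¹ ^ 6 * (β ^ 2)⁻¹ := by ring
  -- `∑_{b ∈ t} b⁻² ≤ 2 / b₀` since every shell index is `≥ b₀`
  have step5 : ∑ b ∈ t, ((b : ℝ) ^ 2)⁻¹ ≤ 2 / b₀ := by
    have hsub : t ⊆ Finset.Ioo (b₀ - 1) (t.sup id + 1) := fun b hb => by
      rw [Finset.mem_Ioo]
      obtain ⟨k, hk, rfl⟩ := Finset.mem_image.1 hb
      exact ⟨by have := hmb k hk; omega, Nat.lt_succ_of_le (Finset.le_sup (f := id) hb)⟩
    have h2 := sum_Ioo_inv_sq_le (α := ℝ) (b₀ - 1) (t.sup id + 1)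
    have hcast : ((b₀ - 1 : ℕ) : ℝ) + 1 = (b₀ : ℝ) := by
      rw [Nat.cast_sub hb₀]; push_cast; ring
    rw [hcast] at h2
    calc ∑ b ∈ t, ((b : ℝ) ^ 2)⁻¹ ≤ ∑ b ∈ Finset.Ioo (b₀ - 1) (t.sup id + 1), ((b : ℝ) ^ 2)⁻¹ :=
          Finset.sum_le_sum_of_subset_of_nonneg hsub fun b _ _ => by positivity
      _ ≤ 2 / b₀ := h2
  have hr6 : 0 ≤ r⁻¹ ^ 6 := by positivity
  calc ∑ k ∈ S, (dist (x i) (x k))⁻¹ ^ 6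
      ≤ ∑ b ∈ t, ((S.filter fun k => m k = b).card : ℝ) * (r⁻¹ ^ 6 * ((b : ℝ))⁻¹ ^ 6) :=
        step1.trans_eq step2
    _ ≤ ∑ b ∈ t, (2 * (b : ℝ) + 3) ^ 3 * (r⁻¹ ^ 6 * ((b : ℝ))⁻¹ ^ 6) :=
        Finset.sum_le_sum fun b hb => mul_le_mul_of_nonneg_right (step3 b hb) (by positivity)
    _ ≤ ∑ b ∈ t, 125 * r⁻¹ ^ 6 * ((b : ℝ) ^ 2)⁻¹ := Finset.sum_le_sum step4
    _ = 125 * r⁻¹ ^ 6 * ∑ b ∈ t, ((b : ℝ) ^ 2)⁻¹ := by rw [Finset.mul_sum]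
    _ ≤ 125 * r⁻¹ ^ 6 * (2 / b₀) := mul_le_mul_of_nonneg_left step5 (by positivity)
    _ = 250 * r⁻¹ ^ 6 / b₀ := by ring


/-- **Goodness transfers from a sub-configuration** when nothing was removed within `3/2` of the
particle: if `k` is good in `x ∘ f` and every particle of `x` outside the range of `f` is farther
than `3/2` from `x (f k)`, then `f k` is good in `x` (same scale, rotation, pattern; assignment
`f ∘ g`). [folklore] -/
theorem good_of_good_comp {N K : ℕ} (x : Fin N → EuclideanSpace ℝ (Fin 3)) (f : Fin K ↪ Fin N)
    (k : Fin K) (hfar : ∀ j : Fin N, j ∉ Set.range f → 3 / 2 < dist (x j) (x (f k)))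
    (h : IsTwoShellGood (1 / 20) (47 / 50) 1 (x ∘ f) k) :
    IsTwoShellGood (1 / 20) (47 / 50) 1 x (f k) := by
  obtain ⟨a, ha₁, ha₂, A, P, g, hP, hg, hinj, hsurj⟩ := h
  refine ⟨a, ha₁, ha₂, A, P, fun v => f (g v), hP, fun v hv => ⟨?_, ?_⟩, ?_, fun j hj hd => ?_⟩
  · exact fun heq => (hg v hv).1 (f.injective heq)
  · simpa [Function.comp] using (hg v hv).2
  · intro v hv w hw hvw
    exact hinj hv hw (f.injective hvw)
  · by_cases hjr : j ∈ Set.range f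
    · obtain ⟨k', rfl⟩ := hjr
      have hk' : k' ≠ k := fun h => hj (by rw [h])
      obtain ⟨v, hv, hgv⟩ := hsurj k' hk' (by simpa [Function.comp] using hd)
      exact ⟨v, hv, by simp [hgv]⟩
    · exfalso
      have := hfar j hjr
      nlinarith

/-- **Fibre / packing count** (the picked line's `stub_fibre`, proved): in a `δ`-separated configuration,
if every particle of `S` lies within `R` of some particle of `T`, then `#S ≤ (2R/δ + 1)³ · #T`.
[folklore] -/
theorem fibre_count {δ R : ℝ} (hδ : 0 < δ) (hR : 0 ≤ R) {N : ℕ} (x : Fin N → EuclideanSpace ℝ (Fin 3))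
    (hsep : ∀ i j : Fin N, i ≠ j → δ ≤ dist (x i) (x j)) (S T : Finset (Fin N))
    (hST : ∀ j ∈ S, ∃ k ∈ T, dist (x j) (x k) ≤ R) :
    (S.card : ℝ) ≤ (2 * R / δ + 1) ^ 3 * (T.card : ℝ) := by
  classical
  set F : Fin N → Finset (Fin N) := fun k => S.filter fun j => dist (x j) (x k) ≤ R with hF
  have hcover : S ⊆ T.biUnion F := by
    intro j hj
    obtain ⟨k, hk, hd⟩ := hST j hj
    exact Finset.mem_biUnion.2 ⟨k, hk, Finset.mem_filter.2 ⟨hj, hd⟩⟩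
  have hfibre : ∀ k ∈ T, ((F k).card : ℝ) ≤ (2 * R / δ + 1) ^ 3 := by
    intro k _
    have hinj : Set.InjOn x (F k) := fun a _ b _ hab => by
      by_contra hne
      have := hsep a b hne
      rw [hab, dist_self] at this
      exact absurd this (not_le.2 hδ)
    rw [← Finset.card_image_of_injOn hinj]
    have h := card_le_of_separated_of_dist_le ((F k).image x) (x k) hδ hR ?_ ?_
    · rwa [finrank_euclideanSpace_fin] at h
    · intro c hc
      obtain ⟨j, hj, rfl⟩ := Finset.mem_image.1 hc
      exact (Finset.mem_filter.1 hj).2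
    · intro c hc c' hc' hne
      obtain ⟨a, -, rfl⟩ := Finset.mem_image.1 hc
      obtain ⟨b, -, rfl⟩ := Finset.mem_image.1 hc'
      exact hsep a b fun h => hne (h ▸ rfl)
  have h1 : (S.card : ℝ) ≤ ((T.biUnion F).card : ℝ) := by
    exact_mod_cast Finset.card_le_card hcover
  have h2 : ((T.biUnion F).card : ℝ) ≤ ∑ k ∈ T, ((F k).card : ℝ) := by
    exact_mod_cast Finset.card_biUnion_le
  have h3 : ∑ k ∈ T, ((F k).card : ℝ) ≤ ∑ k ∈ T, (2 * R / δ + 1) ^ 3 := Finset.sum_le_sum hfibre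
  rw [Finset.sum_const, nsmul_eq_mul] at h3
  linarith

/-- Restriction identity: `Σ_{i∈U} ½ Σ_{j≠i} V(|x_i−x_j|) = E(x ∘ f) + ½ Σ_{i∈U} Σ_{j∉U} V(|x_i−x_j|)`
for any enumeration `f` of `U`. [folklore] -/
theorem sum_halfSite_eq_restrict {N K : ℕ} (x : Fin N → EuclideanSpace ℝ (Fin 3)) (U : Finset (Fin N))
    (f : Fin K ↪ Fin N) (hmap : Finset.univ.map f = U) :
    ∑ i ∈ U, ((1 / 2 : ℝ) * ∑ j ∈ Finset.univ.erase i, lennardJones (dist (x i) (x j))) =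
      interactionEnergy lennardJones (x ∘ f) +
        (1 / 2 : ℝ) * ∑ i ∈ U, ∑ j ∈ Uᶜ, lennardJones (dist (x i) (x j)) := by
  classical
  have hdouble : ∑ i ∈ U, ∑ j ∈ U, lennardJones (dist (x i) (x j)) =
      2 * interactionEnergy lennardJones (x ∘ f) := by
    have := sum_sum_map_eq_two_mul_interactionEnergy lennardJones lennardJones_zero x f
    rwa [hmap] at this
  have herase : ∀ i : Fin N, ∑ j ∈ Finset.univ.erase i, lennardJones (dist (x i) (x j)) =
      ∑ j, lennardJones (dist (x i) (x j)) := fun i =>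
    Finset.sum_erase _ (by rw [dist_self, lennardJones_zero])
  have h1 : ∀ i ∈ U, (1 / 2 : ℝ) * ∑ j ∈ Finset.univ.erase i, lennardJones (dist (x i) (x j)) =
      (1 / 2 : ℝ) * (∑ j ∈ U, lennardJones (dist (x i) (x j)) +
        ∑ j ∈ Uᶜ, lennardJones (dist (x i) (x j))) := fun i _ => by
    rw [herase i, Finset.sum_add_sum_compl]
  rw [Finset.sum_congr rfl h1, ← Finset.mul_sum, Finset.sum_add_distrib, hdouble]
  ring

/-- The whole excess: `Σ_i (½ Σ_{j≠i} V − e*) = E(x) − N e*`. [folklore] -/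
theorem sum_halfSite_sub_eStar {N : ℕ} (x : Fin N → EuclideanSpace ℝ (Fin 3)) :
    ∑ i, (((1 / 2 : ℝ) * ∑ j ∈ Finset.univ.erase i, lennardJones (dist (x i) (x j))) -
      (⨅ Q : PeriodicConfiguration 3, Q.energyPerParticle lennardJones)) =
      interactionEnergy lennardJones x -
        (N : ℝ) * (⨅ Q : PeriodicConfiguration 3, Q.energyPerParticle lennardJones) := by
  rw [Finset.sum_sub_distrib, Finset.sum_const, Finset.card_univ, Fintype.card_fin, nsmul_eq_mul,
    ← Finset.mul_sum]
  have h := two_mul_interactionEnergy lennardJones x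
  simp only [siteEnergy] at h
  linarith

/-- Arithmetic of the convex combination closing the glue. [folklore] -/
theorem glue_arith {X SB SG b c bd g g₂ M C'' A : ℝ} (hsplit : SB + SG = X)
    (hfar : g * b - C'' * bd ≤ SB) (hGs : -A * bd - g / 2 * b ≤ SG) (h1 : C'' * bd + A * bd ≤ M * c)
    (hii : g₂ * c ≤ X) (hg₂ : 0 ≤ g₂) (hM : 0 ≤ M) (hden : 0 < g₂ + M) :
    g₂ * (g / 2) / (g₂ + M) * b ≤ X := by
  have hi : g / 2 * b - M * c ≤ X := by linarith
  rw [div_mul_eq_mul_div, div_le_iff₀ hden]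
  have h1 := mul_le_mul_of_nonneg_left hi hg₂
  have h2 := mul_le_mul_of_nonneg_left hii hM
  nlinarith [h1, h2]

/-- Arithmetic of the cross-term charge. [folklore] -/
theorem cross_arith {S A g bd nf b : ℝ} (hsum : -(2 * A) * bd + -g * nf ≤ S) (hf : nf ≤ b)
    (hg : 0 ≤ g) : -(2 * A) * bd - g * b ≤ S := by
  have := mul_le_mul_of_nonneg_left hf hg
  linarith

end Summit.AtomisticToContinuum.Crystallization.Theorems.NearFarGlueRNegative
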